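import Summits.Ventures.Crystal3D.Theorems.StickyWulffConstantTextureBuildTilingSlack
import Summits.Ventures.Crystal3D.Theorems.StickyWulffConstantTextureBuildRiserLine
import HarnessLib

/-!
# TB-1: the CERTIFIED CELL COVER with RISER PIECES (interface v3) — the tiling identity with risers (and slack)
# (lane T, crux `TextureLiminfV5`, stmt-Ventures-23912; `stub_TB_cover` repair census TB-1-g19 §1 (FINDING R); cf-p1 DECISION (cliii) «A1 = GO: interface v3»)

HONEST FRAMING. Venture `Summits/Ventures/Crystal3D` (cell `crystal3d-full`), route `route-Ventures-StickyWulffConstant`, helper `--supports` the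
law-v5 crux `TextureLiminfV5` (stmt-Ventures-23912).  One DEFINITION (the risered cover) + pure finite combinatorics (census-free, standard axioms).
No cover is constructed, no texture is built, no wall law or adhesion law is proved; rung F-C1 not moved.

WHY (TB-1-g19 §1; ROUTE.md §73.3 (W1)).  The v8.5 interface has no piece kind that certifies the RISER facets of a co-axial layer-sharing interface
(rigid twin steps, partial lines, lamella tips): cylinder cells lose their rim against a charge linear in `ρ`, designation costs `3·(riser area)`, and the
counter-family «Wulff fcc + free twin lamellae + sparse rigid steps» makes `stub_TB_cover` (v8.5) false as typed.  The certificate is LOCAL: a ball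
`b` of the piece whose touching balls lie in its own and the two adjacent layer planes and whose in-plane touching balls are in-plane SITES has
`halfDefect X′ b ≥ ½·#(vacant in-plane sites)` (…TextureBuildRiserLine, p707922).  This file adds the piece kind to the cover:
* `RiseredCover C R₀ N x` EXTENDS `CrustedCover` (…TextureBuildCrustedCover) by finitely many RISER PIECES `r`: two tent indices `rtL r ≠ rtR r`
  (the two column grains; their geometric link — common frame, riser box, in-plane site sets = stacking neighbours — is the MESH's business, part 2),
  a unit normal `rn r`, OWNED balls `rown r ⊆ X′` (disjoint from every other owner), in-plane site sets `rV r b` with `#rV r b ≤ 6`, and the two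
  cleanliness clauses (c1) `hrplanes` / (c2) `hrin` of the riser line;
* `riserSum := Σ_r riserBudget (rown r) (rV r) X′` — what «TB-energy» may spend on riser facets;
* **`RiseredCover.tiling₃`**: `tentBudget + cellBudget + riserSum ≤ (6N′ − C(x′)) + tilingLoss₂` and its SLACK form `tiling₃_slack`
  (`… + unownedSlack₃ ≤ …`, owners now FOUR kinds: tents' owned balls, crust balls, cells' balls, riser balls);
* `tentBudget_add_chargeSum_le₃(_slack)` — with the wall law: `tentBudget + chargeSum + riserSum (+ unownedSlack₃) ≤ (6N − C(x)) + tilingLoss₂ + rimSum`.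
The level-2 composition over `RiseredCover` + the part-2 mesh (territory contacts through riser boxes, relaxed collar/mass) is the sequel.
WHAT THIS IS NOT: no riser is exhibited, no Barlow-layer fact is proved here (the fields `hrV6 / hrplanes / hrin` are the constructor's burden); F-C1 not moved.
-/

noncomputable section

open scoped BigOperators InnerProductSpace ENNReal
open MeasureTheory

namespace Summit.Ventures.Crystal3D.Cruxes.TextureLiminf.TexShadow

open Summit.Ventures.Crystal3D Summit.Ventures.Crystal3D.Theorems Finset
open Literature.MathematicalPhysics.StatisticalMechanics (IsHaggSeq fccStacking barlowStacking contactDeficiency)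

/-- **CERTIFIED CELL COVER WITH CRUST CELLS AND RISER PIECES** (interface v3). -/
structure RiseredCover (C R₀ : ℝ) (N : ℕ) (x : Fin N → E3) extends CrustedCover C R₀ N x where
  /-- riser pieces, each between two tent pieces (column grains) -/
  nr : ℕ
  rtL : Fin nr → Fin ng
  rtR : Fin nr → Fin ng
  hrt : ∀ r, rtL r ≠ rtR r
  /-- the common layer normal of the piece -/
  rn : Fin nr → E3
  hrn : ∀ r, ‖rn r‖ = 1
  /-- owned balls and their in-plane site sets -/
  rown : Fin nr → Finset E3
  hrown : ∀ r, rown r ⊆ Finset.univ.image x'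
  rV : Fin nr → E3 → Finset E3
  hrV6 : ∀ r, ∀ b ∈ rown r, (rV r b).card ≤ 6
  /-- (c1) CO-AXIAL CLEANLINESS: every ball touching an owned ball lies in its own or an adjacent layer plane -/
  hrplanes : ∀ r, ∀ b ∈ rown r, ∀ q ∈ Finset.univ.image x', dist b q = 1 →
    ⟪q - b, rn r⟫_ℝ = 0 ∨ ⟪q - b, rn r⟫_ℝ = Real.sqrt (2 / 3) ∨ ⟪q - b, rn r⟫_ℝ = -Real.sqrt (2 / 3)
  /-- (c2) in-plane touching balls are in-plane sites -/
  hrin : ∀ r, ∀ b ∈ rown r, ∀ q ∈ Finset.univ.image x', dist b q = 1 → ⟪q - b, rn r⟫_ℝ = 0 → q ∈ rV r b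
  /-- riser balls are owned by their piece only -/
  hRR : ∀ r r', r ≠ r' → Disjoint (rown r) (rown r')
  hRT : ∀ r f, Disjoint (rown r) ((tent f).owned (Finset.univ.image x'))
  hRB : ∀ r c, Disjoint (rown r) (cB c)
  hRC : ∀ r k, Disjoint (rown r) (cell k).act

namespace RiseredCover

variable {C R₀ : ℝ} {N : ℕ} {x : Fin N → E3}

/-- total riser budget: what the texture may spend on riser facets -/
def riserSum (rc : RiseredCover C R₀ N x) : ℝ := ∑ r, riserBudget (rc.rown r) (rc.rV r) rc.X'

/-- The riser sum is nonnegative. -/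
theorem riserSum_nonneg (rc : RiseredCover C R₀ N x) : 0 ≤ rc.riserSum :=
  Finset.sum_nonneg fun _ _ => riserBudget_nonneg _ _ _

/-- the riser line, per piece: `riserBudget ≤ Σ_{rown} halfDefect` -/
theorem riserBudget_le (rc : RiseredCover C R₀ N x) (r : Fin rc.nr) :
    riserBudget (rc.rown r) (rc.rV r) rc.X' ≤ ∑ b ∈ rc.rown r, halfDefect rc.X' b :=
  riserBudget_le_sum_halfDefect rc.X' rc.X'_sep (rc.rown r) (rc.rn r) (rc.hrn r) (rc.rV r) (rc.hrV6 r) (rc.hrplanes r) (rc.hrin r)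

/-- the OWNERS of a risered cover: tents' owned balls, crust balls, cells' balls, riser balls -/
def owner₃ (rc : RiseredCover C R₀ N x) : ((Fin rc.ng ⊕ Fin rc.nc) ⊕ Fin rc.nk) ⊕ Fin rc.nr → Finset E3
  | Sum.inl i => rc.toCrustedCover.owner i
  | Sum.inr r => rc.rown r

/-- the union of all owned ball sets -/
def ownedUnion₃ (rc : RiseredCover C R₀ N x) : Finset E3 := Finset.univ.biUnion rc.owner₃

/-- the SLACK: half-defects of the balls no piece owns -/
def unownedSlack₃ (rc : RiseredCover C R₀ N x) : ℝ := ∑ a ∈ rc.X' \ rc.ownedUnion₃, halfDefect rc.X' a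

/-- Every owner is a set of configuration balls. -/
theorem owner₃_subset (rc : RiseredCover C R₀ N x) (i : ((Fin rc.ng ⊕ Fin rc.nc) ⊕ Fin rc.nk) ⊕ Fin rc.nr) : rc.owner₃ i ⊆ rc.X' := by
  rcases i with i | r
  · exact rc.toCrustedCover.owner_subset i
  · exact rc.hrown r

/-- Owners are pairwise disjoint. -/
theorem owner₃_disjoint (rc : RiseredCover C R₀ N x) :
    ∀ i ∈ (Finset.univ : Finset (((Fin rc.ng ⊕ Fin rc.nc) ⊕ Fin rc.nk) ⊕ Fin rc.nr)),
      ∀ j ∈ (Finset.univ : Finset (((Fin rc.ng ⊕ Fin rc.nc) ⊕ Fin rc.nk) ⊕ Fin rc.nr)), i ≠ j → Disjoint (rc.owner₃ i) (rc.owner₃ j) := by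
  rintro (i | r) - (j | r') - hne
  · exact rc.toCrustedCover.owner_disjoint i (Finset.mem_univ _) j (Finset.mem_univ _) (fun h => hne (by rw [h]))
  · rcases i with (f | c) | k
    · exact (rc.hRT r' f).symm
    · exact (rc.hRB r' c).symm
    · exact (rc.hRC r' k).symm
  · rcases j with (f | c) | k
    · exact rc.hRT r f
    · exact rc.hRB r c
    · exact rc.hRC r k
  · exact rc.hRR r r' (fun h => hne (by rw [h]))

/-- The owned union is a set of configuration balls. -/
theorem ownedUnion₃_subset (rc : RiseredCover C R₀ N x) : rc.ownedUnion₃ ⊆ rc.X' :=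
  Finset.biUnion_subset.2 fun i _ => rc.owner₃_subset i

/-- The slack is nonnegative. -/
theorem unownedSlack₃_nonneg (rc : RiseredCover C R₀ N x) : 0 ≤ rc.unownedSlack₃ :=
  Finset.sum_nonneg fun a _ => halfDefect_nonneg rc.X' rc.X'_sep a

/-- The exact half-defect identity split along the four owner kinds. -/
theorem sum_owner₃_halfDefect_add_slack (rc : RiseredCover C R₀ N x) :
    ∑ i, ∑ a ∈ rc.owner₃ i, halfDefect rc.X' a + rc.unownedSlack₃ = contactDeficiency rc.X' := by
  classical
  have h1 : ∑ i, ∑ a ∈ rc.owner₃ i, halfDefect rc.X' a = ∑ a ∈ rc.ownedUnion₃, halfDefect rc.X' a := by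
    unfold ownedUnion₃
    rw [Finset.sum_biUnion rc.owner₃_disjoint]
  rw [h1, contactDeficiency_eq_sum_halfDefect]
  unfold unownedSlack₃
  rw [← Finset.sum_union Finset.disjoint_sdiff, Finset.union_sdiff_of_subset rc.ownedUnion₃_subset]

/-- **THE TILING IDENTITY WITH CRUSTS, RISERS AND SLACK** (`R₀ ≥ 1`):
`tentBudget + cellBudget + riserSum + unownedSlack₃ ≤ (6N′ − C(x′)) + tilingLoss₂`. -/
theorem tiling₃_slack (rc : RiseredCover C R₀ N x) (hR₀ : 1 ≤ R₀) :
    rc.tentBudget + rc.cellBudget + rc.riserSum + rc.unownedSlack₃ ≤ (6 * (rc.N' : ℝ) - (numContacts rc.x' : ℝ)) + rc.tilingLoss₂ := by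
  classical
  have hhd := rc.sum_owner₃_halfDefect_add_slack
  rw [Fintype.sum_sum_type, Fintype.sum_sum_type, Fintype.sum_sum_type] at hhd
  have htent : rc.tentBudget ≤ ∑ f, ∑ a ∈ (rc.tent f).owned rc.X', halfDefect rc.X' a + ∑ f, rc.tentRimSharp f := by
    unfold CellCover.tentBudget
    rw [← Finset.sum_add_distrib]
    exact Finset.sum_le_sum fun f _ => rc.tentBudget_le_sharp f
  have hcell : rc.cellBudget ≤ ∑ k, ∑ a ∈ (rc.cell k).act, halfDefect rc.X' a + ∑ k, (rc.cell k).tilingRim := by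
    unfold CellCover.cellBudget
    rw [← Finset.sum_add_distrib]
    exact Finset.sum_le_sum fun k _ => (rc.cell k).budget_le hR₀
  have hcrust : ∑ c, rc.crustTerm c ≤ ∑ c, ∑ b ∈ rc.cB c, halfDefect rc.X' b + ∑ c, rc.crustRim c := by
    rw [← Finset.sum_add_distrib]
    exact Finset.sum_le_sum fun c _ => rc.crustTerm_le c
  have hriser : rc.riserSum ≤ ∑ r, ∑ b ∈ rc.rown r, halfDefect rc.X' b := by
    unfold riserSum
    exact Finset.sum_le_sum fun r _ => rc.riserBudget_le r
  rw [← rc.contactDeficiency_X']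
  unfold CrustedCover.tilingLoss₂
  have hown₁ : ∑ f, ∑ a ∈ rc.owner₃ (Sum.inl (Sum.inl (Sum.inl f))), halfDefect rc.X' a =
      ∑ f, ∑ a ∈ (rc.tent f).owned rc.X', halfDefect rc.X' a := rfl
  have hown₂ : ∑ c, ∑ a ∈ rc.owner₃ (Sum.inl (Sum.inl (Sum.inr c))), halfDefect rc.X' a = ∑ c, ∑ b ∈ rc.cB c, halfDefect rc.X' b := rfl
  have hown₃ : ∑ k, ∑ a ∈ rc.owner₃ (Sum.inl (Sum.inr k)), halfDefect rc.X' a = ∑ k, ∑ a ∈ (rc.cell k).act, halfDefect rc.X' a := rfl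
  have hown₄ : ∑ r, ∑ a ∈ rc.owner₃ (Sum.inr r), halfDefect rc.X' a = ∑ r, ∑ b ∈ rc.rown r, halfDefect rc.X' b := rfl
  linarith

/-- **THE TILING IDENTITY WITH CRUSTS AND RISERS** (`R₀ ≥ 1`): `tentBudget + cellBudget + riserSum ≤ (6N′ − C(x′)) + tilingLoss₂`. -/
theorem tiling₃ (rc : RiseredCover C R₀ N x) (hR₀ : 1 ≤ R₀) :
    rc.tentBudget + rc.cellBudget + rc.riserSum ≤ (6 * (rc.N' : ℝ) - (numContacts rc.x' : ℝ)) + rc.tilingLoss₂ := by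
  have h := rc.tiling₃_slack hR₀
  have h0 := rc.unownedSlack₃_nonneg
  linarith

/-- **The discrete half with crusts, risers and slack** (wall law at `(C, R₀)`, `R₀ ≥ 1`):
`tentBudget + chargeSum + riserSum + unownedSlack₃ ≤ (6N − C(x)) + tilingLoss₂ + rimSum`. -/
theorem tentBudget_add_chargeSum_le₃_slack (rc : RiseredCover C R₀ N x) (hR₀ : 1 ≤ R₀)
    (hW : ∀ (σ₁ σ₂ : ℤ → ℤ), IsHaggSeq σ₁ → IsHaggSeq σ₂ →
      ∀ (L₁ L₂ : E3 ≃ₗᵢ[ℝ] E3) (s₁ s₂ : E3) (A₁ A₂ : ℤ → (E3 ≃ₗᵢ[ℝ] E3)),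
      (∀ i, ∃ u : E3, bilayer L₁ s₁ σ₁ i ⊆ (fun r => A₁ i r + u) '' fccRef) →
      (∀ j, ∃ u : E3, bilayer L₂ s₂ σ₂ j ⊆ (fun r => A₂ j r + u) '' fccRef) →
      ∀ (c : ℤ → ℤ → ℝ) (m : ℤ → ℤ → E3), (∀ i j, 0 ≤ c i j) → (∀ i j, c i j ≤ 13 / 25) →
      (∀ i j, CoAx (A₁ i) (A₂ j) → A₁ i '' fccRef ≠ A₂ j '' fccRef →
        SharedAxis (m i j) (A₁ i) (A₂ j) ∧ c i j ≤ 1 / 2 * Real.sqrt (1 - ⟪m i j, e₃⟫_ℝ ^ 2)) →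
      (∀ i j, A₁ i '' fccRef = A₂ j '' fccRef → c i j = 0) →
      BilayerWallAt C R₀ σ₁ σ₂ L₁ L₂ s₁ s₂ c) :
    rc.tentBudget + rc.chargeSum + rc.riserSum + rc.unownedSlack₃ ≤
      (6 * (N : ℝ) - (numContacts x : ℝ)) + rc.tilingLoss₂ + rc.rimSum := by
  have h1 := rc.tiling₃_slack hR₀
  have h2 := rc.chargeSum_le hW
  have h3 := rc.hDef
  linarith

/-- **The discrete half with crusts and risers**: `tentBudget + chargeSum + riserSum ≤ (6N − C(x)) + tilingLoss₂ + rimSum`. -/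
theorem tentBudget_add_chargeSum_le₃ (rc : RiseredCover C R₀ N x) (hR₀ : 1 ≤ R₀)
    (hW : ∀ (σ₁ σ₂ : ℤ → ℤ), IsHaggSeq σ₁ → IsHaggSeq σ₂ →
      ∀ (L₁ L₂ : E3 ≃ₗᵢ[ℝ] E3) (s₁ s₂ : E3) (A₁ A₂ : ℤ → (E3 ≃ₗᵢ[ℝ] E3)),
      (∀ i, ∃ u : E3, bilayer L₁ s₁ σ₁ i ⊆ (fun r => A₁ i r + u) '' fccRef) →
      (∀ j, ∃ u : E3, bilayer L₂ s₂ σ₂ j ⊆ (fun r => A₂ j r + u) '' fccRef) →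
      ∀ (c : ℤ → ℤ → ℝ) (m : ℤ → ℤ → E3), (∀ i j, 0 ≤ c i j) → (∀ i j, c i j ≤ 13 / 25) →
      (∀ i j, CoAx (A₁ i) (A₂ j) → A₁ i '' fccRef ≠ A₂ j '' fccRef →
        SharedAxis (m i j) (A₁ i) (A₂ j) ∧ c i j ≤ 1 / 2 * Real.sqrt (1 - ⟪m i j, e₃⟫_ℝ ^ 2)) →
      (∀ i j, A₁ i '' fccRef = A₂ j '' fccRef → c i j = 0) →
      BilayerWallAt C R₀ σ₁ σ₂ L₁ L₂ s₁ s₂ c) :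
    rc.tentBudget + rc.chargeSum + rc.riserSum ≤ (6 * (N : ℝ) - (numContacts x : ℝ)) + rc.tilingLoss₂ + rc.rimSum := by
  have h := rc.tentBudget_add_chargeSum_le₃_slack hR₀ hW
  have h0 := rc.unownedSlack₃_nonneg
  linarith

end RiseredCover

end Summit.Ventures.Crystal3D.Cruxes.TextureLiminf.TexShadow

end
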